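/- Copyright: the b2b-balaban cell (near-miss cell 7), T⁴-continuum fan-out, ROUND-2 swarm `t4-ne7b-formalise-*`
(leaf 08), row NE7b (node U5c COUNT member).  Released under the licence of the surrounding project. -/
import Summits.QuantumFields.BalabanUV.T4Continuum.Support.HistoryRealiseTimed
import Summits.QuantumFields.BalabanUV.T4Continuum.Support.HistoryGenTimedLE

/-!
# Realised pedigrees are `TimedLE`: the assembly's displayed timing from the geometry
(swarm row S1b «H1b geometric layer», part 4: the per-part form on leaf-09's pedigree)

Summits-side support leaf of the T⁴-continuum cell (rung (B)+1 on a FINITE torus only; NOT infinite volume, NOT the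
mass gap, NOT the Clay statement; NOT a proof of the spine estimate NE7b).  Row S1b of the swarm claim table
`t4/b2b-balaban-t4-ne7b-p1/LEAVES-NE7b.md` (parts 1–3: `HistoryWindows` p208941, `HistoryRealise` p209120,
`HistoryRealiseTimed` p209488).  [folklore] bookkeeping over the lineage's OWN carriers; nothing printed is asserted;
no `[cite:]` tag; no `def`.

WHY.  The assembly `HistoryAssemblyPedigree` (leaf-03) displays, per term and cutoff, leaf-09's timing structure on the
pedigree — `Timed` today, `TimedLE` (leaf-02's `HistoryGenTimedLE`, row S4c: renewal NO LATER than the booked reach)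
after the one-token switch — whose fields `renew_reach` and `alive` quantify over the PARTS of every component.  Part 3
gave the member fields `consistent`∕`pending` directly; THIS PART gives the per-part structure itself, so that the
assembly's `PedigreeReading.timed` can be replaced by the realisation verbatim: **every pedigree all of whose components
are realised (through the bridge `Pedigree.toPGen`) is `TimedLE`**, given only the encoding conventions `step ≤ K` and
`renew_step`.

WHAT.  §1 chains of joins: every member of a realised chain is realised (`realises_chainJoin_mem`), and when the chain
is proper every member is pending at the join step, hence inside its booked life (`lt_reach_of_chainJoin`).  §2
**`timedLE_of_realises`**: `(∀ c, step c ≤ K) → renew_step → (∀ c, ∃ Z, Realises L s R (P.toPGen cell c) Z) →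
TimedLE P K (dictWT Prod.fst R C.n₁)`.

HONEST.  Junction lemmas; the equality half of `Timed.renew_reach` is NOT claimed (F-1(c)); NE7b NOT proved; spine 0∕9.
HONEST DEPENDENCY (cell): continuum YM on T⁴ ⇐ BetaPertH ∧ nine spine estimates (0/9 proved); BetaPertH ⇐ (D1) ∧ (D4)
∧ CAP+tail; G-an2-4 gates asym, D1 and NE2/3/4.  This file changes none of it. -/

open Finset
open Literature.MathematicalPhysics.QuantumFieldTheory.Balaban1983to89
open Literature.MathematicalPhysics.QuantumFieldTheory.Balaban1983to89.B13ScaleTransfer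
open T4PersistenceDictionary T4TaggedShapeBanking
open Summit.QuantumFields.BalabanUV.T4Continuum.ZoneSkeleton
open Summit.QuantumFields.BalabanUV.T4Continuum.HistoryAdmissible
open Summit.QuantumFields.BalabanUV.T4Continuum.HistoryBankingLE
open Summit.QuantumFields.BalabanUV.T4Continuum.HistoryGen
open Summit.QuantumFields.BalabanUV.T4Continuum.HistoryGenTimedLE

namespace Summit.QuantumFields.BalabanUV.T4Continuum.HistoryRealise

variable {d : ℕ} {L : ℕ} {s R : ℕ → ℕ}

/-! ## §1 Chains of joins at one step -/

/-- **EVERY MEMBER OF A REALISED CHAIN IS REALISED** (the join clause hands down realisations of both partners).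
[folklore] -/
theorem realises_chainJoin_mem : ∀ (A : PGen (Pt d × Finset (Pt d))) (Bs : List (PGen (Pt d × Finset (Pt d))))
    (sj : ℕ) (Z : Finset (Pt d)), Realises L s R (chainJoin A Bs sj) Z →
      ∀ B ∈ A :: Bs, ∃ ZB, Realises L s R B ZB
  | A, [], _, Z, h, B, hB => by
      rw [List.mem_singleton] at hB
      subst hB
      exact ⟨Z, h⟩
  | A, B :: Bs, sj, Z, h, B', hB' => by
      rw [chainJoin] at h
      have ih := realises_chainJoin_mem (PGen.join A B sj) Bs sj Z h
      obtain ⟨ZJ, hJ⟩ := ih _ List.mem_cons_self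
      obtain ⟨ZX, ZY, hX, hY, -⟩ := hJ
      rcases List.mem_cons.1 hB' with rfl | hB'
      · exact ⟨ZX, hX⟩
      rcases List.mem_cons.1 hB' with rfl | hB''
      · exact ⟨ZY, hY⟩
      · exact ih B' (List.mem_cons_of_mem _ hB'')

section Main

variable (hL : 4 ≤ L) (hdrop : ∀ m, B16SProfile.DropCtl s m) (hR : ∀ t, 1 ≤ R t) {n₁ : ℕ} (hn₁ : 13 ≤ n₁)
include hL hdrop hR hn₁

/-- **IN A REALISED PROPER CHAIN EVERY MEMBER IS INSIDE ITS BOOKED LIFE AT THE JOIN STEP**: the join clause makes both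
partners of every node pending at `sj`, and pending is inside the booked life (`lt_reach_of_pendingAt`). [folklore] -/
theorem lt_reach_of_chainJoin : ∀ (A : PGen (Pt d × Finset (Pt d))) (Bs : List (PGen (Pt d × Finset (Pt d))))
    (sj : ℕ) (Z : Finset (Pt d)), Realises L s R (chainJoin A Bs sj) Z → Bs ≠ [] →
      ∀ B ∈ A :: Bs, sj < B.toGen.reach (dictW R n₁)
  | _, [], _, _, _, h, _, _ => absurd rfl h
  | A, B :: Bs, sj, Z, h, _, B', hB' => by
      rw [chainJoin] at h
      obtain ⟨ZJ, hJ⟩ := realises_chainJoin_mem (PGen.join A B sj) Bs sj Z h _ List.mem_cons_self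
      obtain ⟨ZX, ZY, hX, hY, -, -, hpX, hpY, -, -⟩ := hJ
      rcases List.mem_cons.1 hB' with rfl | hB'
      · exact lt_reach_of_pendingAt hL hdrop hR hn₁ hX hpX
      rcases List.mem_cons.1 hB' with rfl | hB''
      · exact lt_reach_of_pendingAt hL hdrop hR hn₁ hY hpY
      · cases Bs with
        | nil => simp at hB''
        | cons B₂ Bs₂ =>
            exact lt_reach_of_chainJoin (PGen.join A B sj) (B₂ :: Bs₂) sj Z h (List.cons_ne_nil _ _) B'
              (List.mem_cons_of_mem _ hB'')

end Main

/-! ## §2 Realised pedigrees are `TimedLE` -/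

section OnPedigree

variable {α π : Type*} (P : Pedigree α π) (cell : π → Pt d × Finset (Pt d))

/-- the `PGen` of a part of `c` is a member of the chain `toPGen cell c` unfolds to [folklore] -/
theorem toPGen_eq_chainJoin {c : α} {q : Part α π} (hq : q ∈ P.parts c) :
    ∃ A As, P.toPGen cell c = chainJoin A As (P.step c) ∧
      P.partPGen cell c (P.toPGen cell) q ∈ A :: As ∧ (2 ≤ (P.parts c).length → As ≠ []) := by
  have hmem : P.partPGen cell c (P.toPGen cell) q ∈ (P.parts c).map (P.partPGen cell c (P.toPGen cell)) :=
    List.mem_map_of_mem hq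
  rw [P.toPGen_eq cell c]
  cases hps : (P.parts c).map (P.partPGen cell c (P.toPGen cell)) with
  | nil => rw [hps] at hmem; simp at hmem
  | cons A As =>
      rw [hps] at hmem
      refine ⟨A, As, rfl, hmem, fun h2 hAs => ?_⟩
      subst hAs
      have hlen := congrArg List.length hps
      simp only [List.length_map, List.length_cons, List.length_nil] at hlen
      omega

variable (hL : 4 ≤ L) (hdrop : ∀ m, B16SProfile.DropCtl s m) (hR : ∀ t, 1 ≤ R t) (C : T4PrintedShapeBanking.Consts)
  (hn₁ : 13 ≤ C.n₁)
include hL hdrop hR hn₁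

/-- **REALISED PEDIGREES ARE `TimedLE`.**  If every component of the pedigree is realised through the bridge
(`∃ Z, Realises L s R (P.toPGen cell c) Z`), every component is observed by the cutoff and renewed parts come from the
previous step, then leaf-02's `TimedLE P K (dictWT Prod.fst R C.n₁)` holds: `renew_reach` (with `≤`) by
`renew_lt_reach` on the renewal member of the chain, `alive` by `lt_reach_of_chainJoin`. [folklore] -/
theorem timedLE_of_realises {K : ℕ} (hstep : ∀ c, P.step c ≤ K)
    (hS : ∀ c c', Part.old c' true ∈ P.parts c → P.step c' + 1 = P.step c)
    (hreal : ∀ c, ∃ Z, Realises L s R (P.toPGen cell c) Z) : TimedLE P K (dictWT Prod.fst R C.n₁) where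
  step_le := hstep
  renew_step := hS
  renew_reach c c' hq := by
    obtain ⟨Z, hZ⟩ := hreal c
    obtain ⟨A, As, hch, hmem, -⟩ := toPGen_eq_chainJoin P cell hq
    rw [hch] at hZ
    obtain ⟨ZE, hE⟩ := realises_chainJoin_mem A As (P.step c) Z hZ _ hmem
    have hlt := renew_lt_reach hL hdrop hR hn₁ (G := P.toPGen cell c') (h := P.step c') hE
    rw [P.toGen_toPGen cell hS c', Pedigree.reach_gen] at hlt
    have hlt' : P.step c' < (P.genT c').reach (dictWT Prod.fst R C.n₁) := hlt
    have hs := hS c c' hq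
    show P.step c ≤ (P.genT c').reach (dictWT Prod.fst R C.n₁)
    omega
  alive c c' hq h2 := by
    obtain ⟨Z, hZ⟩ := hreal c
    obtain ⟨A, As, hch, hmem, hne⟩ := toPGen_eq_chainJoin P cell hq
    rw [hch] at hZ
    have hlt := lt_reach_of_chainJoin hL hdrop hR hn₁ A As (P.step c) Z hZ (hne h2) _ hmem
    rw [show P.partPGen cell c (P.toPGen cell) (Part.old c' false) = P.toPGen cell c' from rfl,
      P.toGen_toPGen cell hS c', Pedigree.reach_gen] at hlt
    exact hlt

/-- hence the tagged genealogies of all components are `ConsistentTLE` by leaf-02's route as well (cf. part 3's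
direct `consistentTLE_genT_of_realises`) [folklore] -/
theorem consistentTLE_genT_of_realises' {K : ℕ} (hstep : ∀ c, P.step c ≤ K)
    (hS : ∀ c c', Part.old c' true ∈ P.parts c → P.step c' + 1 = P.step c)
    (hreal : ∀ c, ∃ Z, Realises L s R (P.toPGen cell c) Z) (c : α) : ConsistentTLE Prod.fst C K R (P.genT c) :=
  consistentTLE_genT (timedLE_of_realises P cell hL hdrop hR C hn₁ hstep hS hreal) c

end OnPedigree

end Summit.QuantumFields.BalabanUV.T4Continuum.HistoryRealise
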